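import Summits.BirchSwinnertonDyer.BirchSwinnertonDyer.Theorems.EisensteinDepletionAtTwoStarOptBSFSigmaNodeMid
import Literature.NumberTheory.EllipticCurves.CuspFormLFunctionLevelConductorProofs
import Literature.NumberTheory.EllipticCurves.ModularityVersionApProofs
import Literature.NumberTheory.EllipticCurves.OrdinaryPrimesProofs
import Literature.NumberTheory.EllipticCurves.NoEverywhereGoodReductionRat
import Literature.NumberTheory.EllipticCurves.NeumannSetzerCurves
import HarnessLib

/-!
# Line `star` on crux E1M (stmt-BirchSwinnertonDyer-20341): the `15a1` shape has level `15` — the `α = −34` clause of (T2″) discharged modulo Setzer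

Lead star-p1 GEN 17.  After the MID walk and the node law (Theorems/…MidWalk, …SigmaNodeMid) the archimedean residue (T2) of E1M's squarefree case is
(T2″) «a MID point of the lattice-optimal `W₀` of a habitat class at squarefree `N ≠ 15` has complementary discriminant `≠ −256` and `α = b₂ + 12m ≠ −34`».
THIS FILE removes the `α`-clause: in the `+256` branch `α = −34` pins `β = 225/8` and `Δ(W₀) = 64β² = 50625 = 3⁴·5⁴`; every prime of the level `N` is a bad
prime of `W₀` (`IsNewformOf.dvd_level_iff_dvd_conductorNorm`), hence divides the minimal discriminant, hence is `3` or `5`; `N = N_W` is squarefree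
(`IsNewformOf.level_eq_conductorNorm_of_squarefree`), so `N ∣ 15`; `N ≠ 15` by hypothesis, `N ≠ 1` because some prime is bad (Tate–Ogg,
`exists_prime_not_hasGoodReductionAtPrime`), and `N ∈ {3, 5}` is a PRIME conductor of a curve with a rational 2-torsion point, excluded by Setzer's classification
(`N = 17` or `N = u² + 64 ≥ 64`).  So the registered research content of (T2) becomes
  (T2‴) «no MID point of Neumann–Setzer shape (complementary discriminant `−256`) on the lattice-optimal curve of a habitat class at squarefree level `≠ 15`».

* `false_of_fifteenShape` — habitat binders + `+256` + `α = −34` ⇒ `False` (mod Setzer);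
* `partnerNotCentre_of_sigmaNode_of_setzer` — (T2′) ⇐ UBD + Edixhoven + Setzer + (N256) + (T2‴).

CONDITIONAL on the prints (UBD, Edixhoven, Setzer) and on (N256), (T2‴) where stated; no `sorry`, no new definition; nothing here reads `r_an`; BSD NOT proved.
-/

set_option linter.dupNamespace false
set_option autoImplicit false

noncomputable section

open scoped Classical MatrixGroups
open CongruenceSubgroup
open WeierstrassCurve Literature.NumberTheory.EllipticCurves Literature.NumberTheory.EllipticCurves.Greenberg1999
open Literature.NumberTheory.EllipticCurves.ModularForms

namespace Summit.BirchSwinnertonDyer.BirchSwinnertonDyer.Theorems.DepletionAtTwo.SigmaNode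

/-! ### Arithmetic of `50625 = 3⁴·5⁴` -/

/-- A prime dividing `50625 = 3⁴·5⁴` is `3` or `5`. [folklore] -/
theorem eq_three_or_five_of_prime_dvd {p : ℕ} (hp : p.Prime) (h : p ∣ 50625) : p = 3 ∨ p = 5 := by
  have h' : p ∣ 3 ^ 4 * 5 ^ 4 := by norm_num at h ⊢; exact h
  rcases (Nat.Prime.dvd_mul hp).mp h' with h3 | h5
  · left; exact (Nat.prime_dvd_prime_iff_eq hp Nat.prime_three).mp (hp.dvd_of_dvd_pow h3)
  · right; exact (Nat.prime_dvd_prime_iff_eq hp Nat.prime_five).mp (hp.dvd_of_dvd_pow h5)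

/-- A squarefree natural number all of whose prime factors are `3` or `5` divides `15`. [folklore] -/
theorem dvd_fifteen_of_squarefree {N : ℕ} (hsq : Squarefree N) (h : ∀ p : ℕ, p.Prime → p ∣ N → p = 3 ∨ p = 5) : N ∣ 15 := by
  have hsub : N.primeFactors ⊆ ({3, 5} : Finset ℕ) := by
    intro p hp
    rcases h p (Nat.prime_of_mem_primeFactors hp) (Nat.dvd_of_mem_primeFactors hp) with rfl | rfl <;> simp
  have h15 : ∏ p ∈ ({3, 5} : Finset ℕ), p = 15 := by decide
  rw [← Nat.prod_primeFactors_of_squarefree hsq, ← h15]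
  exact Finset.prod_dvd_prod_of_subset _ _ _ hsub

/-! ### The `15a1` shape has level 15 -/

/-- **`+256` and `α = −34` on the lattice-optimal curve of a habitat class at squarefree level `N ≠ 15` is impossible** (mod Setzer).
`Δ(W₀) = 50625`; primes of `N` are bad for `W₀`, so divide `50625`, so are `3` or `5`; `N = N_W` squarefree ⇒ `N ∣ 15`; `N ≠ 15`; `N ≠ 1` (a bad prime of `W`
exists); `N ∈ {3,5}` prime contradicts Setzer for `W`. CONDITIONAL on `Setzer1975_primeConductor_rationalTwoTorsion`.
[cite: Setzer1975, pp. 367–378 (main theorem)] [cite: AtkinLehner1970, Thm. 3] [cite: SilvermanAEC2009, VII.5 Prop. 5.1 (a)] -/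
theorem false_of_fifteenShape (hS : Setzer1975_primeConductor_rationalTwoTorsion)
    (W : WeierstrassCurve ℚ) [W.IsElliptic] [W.IsGloballyMinimal] {x : ℚ} (hx : HasRationalTwoTorsionX W x)
    (h15 : W.conductorNorm ℤ ≠ 15) (hsf : Squarefree (W.conductorNorm ℤ))
    {N : ℕ} [NeZero N] (f : CuspForm (Gamma0 N) 2) (hW : IsNewformOf W f)
    (W₀ : WeierstrassCurve ℚ) [W₀.IsElliptic] [W₀.IsGloballyMinimal] (hW₀ : IsNewformOf W₀ f)
    {x₀ : ℚ} (hx₀ : HasRationalTwoTorsionX W₀ x₀)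
    (h256 : (W₀.b₂ + 12 * x₀) ^ 2 - 32 * (W₀.b₄ + x₀ * W₀.b₂ + 6 * x₀ ^ 2) = 256) (hα : W₀.b₂ + 12 * x₀ = -34) : False := by
  -- `Δ(W₀) = 50625`
  have h4 := four_mul_Δ_eq W₀ hx₀
  have hβ : W₀.b₄ + x₀ * W₀.b₂ + 6 * x₀ ^ 2 = 225 / 8 := by
    have : (W₀.b₂ + 12 * x₀) ^ 2 = 1156 := by rw [hα]; norm_num
    linarith
  have hΔ : W₀.Δ = 50625 := by
    rw [h256, hβ] at h4; linarith
  have hΔint : minimalDiscriminantInt W₀ = 50625 := by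
    have h := cast_minimalDiscriminantInt W₀
    rw [hΔ] at h
    exact_mod_cast h
  -- the level equals `N_W`, squarefree
  have hNW : N = W.conductorNorm ℤ := hW.level_eq_conductorNorm_of_squarefree hsf
  have hsqN : Squarefree N := by rw [hNW]; exact hsf
  -- primes of `N` are `3` or `5`
  have hprimes : ∀ p : ℕ, p.Prime → p ∣ N → p = 3 ∨ p = 5 := by
    intro p hp hpN
    haveI : Fact p.Prime := ⟨hp⟩
    have hpW₀ : p ∣ W₀.conductorNorm ℤ := (hW₀.dvd_level_iff_dvd_conductorNorm hp).mp hpN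
    have hbad : ¬ W₀.HasGoodReductionAtPrime p := (W₀.dvd_conductorNorm_iff_not_hasGoodReductionAtPrime p).mp hpW₀
    have hdvd : (p : ℤ) ∣ minimalDiscriminantInt W₀ := by
      by_contra h
      exact hbad (hasGoodReductionAtPrime_of_not_dvd W₀ p h)
    rw [hΔint] at hdvd
    exact eq_three_or_five_of_prime_dvd hp (by exact_mod_cast hdvd)
  have hN15 : N ∣ 15 := dvd_fifteen_of_squarefree hsqN hprimes
  have hNmem : N ∈ Nat.divisors 15 := Nat.mem_divisors.mpr ⟨hN15, by norm_num⟩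
  have hdiv : Nat.divisors 15 = {1, 3, 5, 15} := by decide
  rw [hdiv] at hNmem
  simp only [Finset.mem_insert, Finset.mem_singleton] at hNmem
  rcases hNmem with h1 | h3 | h5 | h15'
  · -- `N = 1`: some prime is bad for `W`
    obtain ⟨p, hp, hbad⟩ := W.exists_prime_not_hasGoodReductionAtPrime
    have hpN : p ∣ W.conductorNorm ℤ := (W.dvd_conductorNorm_iff_not_hasGoodReductionAtPrime p).mpr hbad
    rw [← hNW, h1] at hpN
    exact hp.out.ne_one (Nat.dvd_one.mp hpN)
  · -- `N = 3`: Setzer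
    have hpr : (W.conductorNorm ℤ).Prime := by rw [← hNW, h3]; exact Nat.prime_three
    rcases hS W x hx hpr with h17 | ⟨u, -, hu, -⟩
    · rw [← hNW, h3] at h17; exact absurd h17 (by norm_num)
    · rw [← hNW, h3] at hu; push_cast at hu; nlinarith [sq_nonneg u]
  · -- `N = 5`: Setzer
    have hpr : (W.conductorNorm ℤ).Prime := by rw [← hNW, h5]; exact Nat.prime_five
    rcases hS W x hx hpr with h17 | ⟨u, -, hu, -⟩
    · rw [← hNW, h5] at h17; exact absurd h17 (by norm_num)
    · rw [← hNW, h5] at hu; push_cast at hu; nlinarith [sq_nonneg u]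
  · exact h15 (by rw [← hNW, h15'])

/-! ### (T2′) from (N256) and the Neumann–Setzer-shape exclusion (T2‴) -/

/-- **(T2′) «the MID point's partner is not a centre» from UBD + Edixhoven + Setzer + the node law (N256) + (T2‴) «no `−256`-shape MID point on the lattice-optimal
curve of a habitat class at squarefree level `≠ 15`»** (all stated inline with the registered binders).  `+256`: a centre partner forces `α = −34`
(`alpha_eq_neg_of_mid_of_isSquare`), impossible by `false_of_fifteenShape`; `−256`: excluded by (T2‴).  CONDITIONAL on the prints and the two research
statements. [cite: Setzer1975, pp. 367–378] [cite: CalegariDimitrovTang2025, Thm. 1.0.1] [cite: Edixhoven1991, Prop. 2] [cite: ConradEdixhovenStein2003, Thm. 1.1.1] -/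
theorem partnerNotCentre_of_sigmaNode_of_setzer
    (hU : Literature.NumberTheory.Automorphic.CalegariDimitrovTang2025_unboundedDenominators)
    (hEd : edixhoven_optimalManinConstant_integral) (hS : Setzer1975_primeConductor_rationalTwoTorsion)
    (hN : ∀ (W₀ : WeierstrassCurve ℚ) [W₀.IsElliptic] [W₀.IsGloballyMinimal]
      ⦃N : ℕ⦄ [NeZero N] (f : CuspForm (Gamma0 N) 2), IsNewformOf W₀ f → IsOrdinaryAt W₀ 2 →
      ∀ (L₀ : PeriodPair), IsNeronLatticeOf (W₀.baseChange ℂ) L₀ → ∀ (q : ℚ), q ≠ 0 →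
      (∀ z ∈ periodLattice f, (q : ℂ) * z ∈ L₀.lattice) → (∀ z ∈ L₀.lattice, ∃ w ∈ periodLattice f, z = (q : ℂ) * w) →
      ∀ (x : ℚ), HasRationalTwoTorsionX W₀ x → TwoTorsionRamifiedAtTwo x →
      ∀ (lam : ℂ), lam ∈ L₀.lattice → lam / 2 ∉ L₀.lattice →
        L₀.weierstrassP (lam / 2) - ((W₀.b₂ : ℚ) : ℂ) / 12 = ((x : ℚ) : ℂ) →
      (∀ (γ : SL(2, ℤ)) (hγ : γ ∈ Gamma0 N), γ ∈ Gamma1 N →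
        ∃ k : ℤ, ∃ w ∈ L₀.lattice, (q : ℂ) * cuspSymbol f ⟨γ, hγ⟩ = (k : ℂ) * lam + 2 * w) →
      (W₀.b₂ + 12 * x) ^ 2 - 32 * (W₀.b₄ + x * W₀.b₂ + 6 * x ^ 2) = 256 ∨
        (W₀.b₂ + 12 * x) ^ 2 - 32 * (W₀.b₄ + x * W₀.b₂ + 6 * x ^ 2) = -256)
    (hT2''' : ∀ (W : WeierstrassCurve ℚ) [W.IsElliptic] [W.IsGloballyMinimal] (x : ℚ), IsOrdinaryAt W 2 →
      HasUniqueRationalTwoTorsionX W x →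
      ((TwoTorsionRamifiedAtTwo x ∧ ¬ TwoTorsionOdd W x) ∨ (TwoTorsionOdd W x ∧ ¬ TwoTorsionRamifiedAtTwo x)) →
      W.conductorNorm ℤ ≠ 15 → Squarefree (W.conductorNorm ℤ) →
      ∀ ⦃N : ℕ⦄ [NeZero N] (f : CuspForm (Gamma0 N) 2), IsNewformOf W f →
      ∀ (W₀ : WeierstrassCurve ℚ) [W₀.IsElliptic] [W₀.IsGloballyMinimal], IsNewformOf W₀ f →
      ∀ (L₀ : PeriodPair), IsNeronLatticeOf (W₀.baseChange ℂ) L₀ → ∀ (q : ℚ), q ≠ 0 →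
      (∀ z ∈ periodLattice f, (q : ℂ) * z ∈ L₀.lattice) → (∀ z ∈ L₀.lattice, ∃ w ∈ periodLattice f, z = (q : ℂ) * w) →
      ∀ (x₀ : ℚ), HasRationalTwoTorsionX W₀ x₀ → TwoTorsionRamifiedAtTwo x₀ → TwoTorsionOdd W₀ x₀ →
      (W₀.b₂ + 12 * x₀) ^ 2 - 32 * (W₀.b₄ + x₀ * W₀.b₂ + 6 * x₀ ^ 2) ≠ -256) :
    ∀ (W : WeierstrassCurve ℚ) [W.IsElliptic] [W.IsGloballyMinimal] (x : ℚ), IsOrdinaryAt W 2 →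
      HasUniqueRationalTwoTorsionX W x →
      ((TwoTorsionRamifiedAtTwo x ∧ ¬ TwoTorsionOdd W x) ∨ (TwoTorsionOdd W x ∧ ¬ TwoTorsionRamifiedAtTwo x)) →
      W.conductorNorm ℤ ≠ 15 → Squarefree (W.conductorNorm ℤ) →
      ∀ ⦃N : ℕ⦄ [NeZero N] (f : CuspForm (Gamma0 N) 2), IsNewformOf W f →
      ∀ (W₀ : WeierstrassCurve ℚ) [W₀.IsElliptic] [W₀.IsGloballyMinimal], IsNewformOf W₀ f →
      ∀ (L₀ : PeriodPair), IsNeronLatticeOf (W₀.baseChange ℂ) L₀ → ∀ (q : ℚ), q ≠ 0 →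
      (∀ z ∈ periodLattice f, (q : ℂ) * z ∈ L₀.lattice) → (∀ z ∈ L₀.lattice, ∃ w ∈ periodLattice f, z = (q : ℂ) * w) →
      ∀ (x₀ : ℚ), HasRationalTwoTorsionX W₀ x₀ → TwoTorsionRamifiedAtTwo x₀ → TwoTorsionOdd W₀ x₀ →
      ¬ IsSquare ((W₀.b₄ + x₀ * W₀.b₂ + 6 * x₀ ^ 2) / 2) := by
  intro W _ _ x hord hux htype h15 hsf N _ f hW W₀ _ _ hW₀ L₀ hL₀ q hq hin hout x₀ hx₀ hR₀ hO₀ hsq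
  have hne256 := hT2''' W x hord hux htype h15 hsf f hW W₀ hW₀ L₀ hL₀ q hq hin hout x₀ hx₀ hR₀ hO₀
  have hiso : WeierstrassCurve.IsIsogenous W W₀ :=
    IsNewformOf.isIsogenous WeierstrassCurve.isIsogenous_iff_frobeniusTrace_eq_holds hW hW₀
  have hord₀ : IsOrdinaryAt W₀ 2 := Summit.BirchSwinnertonDyer.BirchSwinnertonDyer.Theorems.IsogenyMuShift.isOrdinaryAt_of_isIsogenous hiso hord
  obtain ⟨lam, hlam, hlam2, hwp⟩ := exists_half_period_of_hasRationalTwoTorsionX W₀ L₀ hL₀ hx₀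
  have hpar := ThmAFormal.kummerParity_formal_of_mem_gamma1 hU hEd W₀ f hW₀ L₀ hL₀ q hq hin hout x₀ hx₀ hR₀ lam hlam hlam2 hwp
  rcases hN W₀ f hW₀ hord₀ L₀ hL₀ q hq hin hout x₀ hx₀ hR₀ lam hlam hlam2 hwp hpar with h256 | hneg
  · have hα := alpha_eq_neg_of_mid_of_isSquare W₀ hord₀.1 hx₀ hR₀ hO₀ h256 hsq
    exact false_of_fifteenShape hS W hux.1 h15 hsf f hW W₀ hW₀ hx₀ h256 hα
  · exact hne256 hneg

end Summit.BirchSwinnertonDyer.BirchSwinnertonDyer.Theorems.DepletionAtTwo.SigmaNode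

end
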